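import Summits.BirchSwinnertonDyer.BirchSwinnertonDyer.Theorems.BiquadraticEisensteinDescentHeegnerTwistCouplingInSupplyThreeSquaresPin
import Summits.BirchSwinnertonDyer.BirchSwinnertonDyer.Theorems.BiquadraticEisensteinDescentHeegnerTwistCouplingInSupplyThreeSquaresPinDual
import Summits.BirchSwinnertonDyer.BirchSwinnertonDyer.Theorems.BiquadraticEisensteinDescentHeegnerTwistCouplingInSupplyMonskyCells
import Literature.NumberTheory.EllipticCurves.AnalyticRankOrderProofs
import Literature.NumberTheory.EllipticCurves.BSDWave0TunnellProofs
import HarnessLib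

set_option linter.dupNamespace false -- `Summit.BirchSwinnertonDyer.BirchSwinnertonDyer.Theorems.…` (summit = sub)
set_option autoImplicit false

/-!
# Crux `HeegnerTwistCouplingInSupply` (stmt-BirchSwinnertonDyer-21381) — from the three-squares pin to ANALYTIC RANK ZERO
# of the Heegner twist on the congruent corners (card `three-squares-heegner-pin`, the `L`-half of its corner targets)

Route `BiquadraticEisensteinDescent` (cell `pub/bsd-wall`, row-12 line lead `bsd-line-ibd-p1` g10). Assembly of this
session's three files — the `(5,−)`-pin (p642610 `…ThreeSquaresPin`), the `(3,−)`-pin for `p ≡ 7 (mod 8)` (p643125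
`…ThreeSquaresPinDual`) and the Rédei-robust Monsky cells (p643875 `…MonskyCells`) — with the tree's journal door
`HeathBrown1994.bsdTriple_of_monsky_of_BT_BF_{even,odd}` (Monsky's `2`-descent matrix theorem + Burungale–Tian's rank-zero
`2`-converse for CM curves + Deuring–Hecke + Burungale–Flach, all as NAMED FACTS, explicit binders):

* `exists_pin_analyticRank_eq_zero_two_p` — corner `W = E_{2p}`, `p ≡ 11 (mod 12)` prime: there is a prime `ℓ < 2p`,
  `ℓ ≡ 5 (mod 8)`, `(ℓ/p) = −1`, with `d = −3ℓ ≡ 1 (mod 8)`, `(d/p) = +1`, `3ℓ < 6p`, such that the twist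
  `E_{2p}^{(d)} = E_{2p·3ℓ}` has ANALYTIC RANK `0`, `L(E_{2p·3ℓ}, 1) ≠ 0` (`entireLFunction 1 ≠ 0`) and the BSD triple;
* `exists_pin_analyticRank_eq_zero_p` — corner `W = E_p`, `p ≡ 23 (mod 24)`: the same with `E_{p·3ℓ}`;
* `exists_dualPin_analyticRank_eq_zero_two_p` — corner `W = E_{2p}`, `p ≡ 7 (mod 8)`, `p ≡ ±1 (mod 5)`: a prime `ℓ′ < p`,
  `ℓ′ ≡ 3 (mod 8)`, `(ℓ′/p) = −1`, `d = −5ℓ′`, twist `E_{2p·5ℓ′}` of analytic rank `0`.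

This is the `L`-HALF of the card's corner theorems in the tree's currency, modulo refereed named facts only (no TYZ parity
input needed). What is NOT here (the other half of `CruxOnE2pCornerMod12` etc.): the witness field `K′ = ℚ(√d)` as a
`NumberField` with `discr K′ = d`, `SatisfiesHeegnerHypothesis (conductorNorm W) K′` via the splitting criterion, and
`classNumber K′ < p` from `|d| < 6p` (tree: `ClassNumberLeSqrtMulLog`, binQF tables for small `p`). THEOREMS ONLY; every
arithmetic input is a hypothesis BY NAME; nothing about the crux (all CM `W`) or any case of BSD beyond these named-fact
consequences is asserted. Supports stmt-BirchSwinnertonDyer-21381 (typed sub-corner rung, not the crux).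
-/

namespace Summit.BirchSwinnertonDyer.BirchSwinnertonDyer.Theorems.BiquadraticEisensteinDescentHeegnerTwistCouplingInSupplyThreeSquaresPinRankZero

open Literature.NumberTheory.EllipticCurves Literature.NumberTheory.EllipticCurves.HeathBrown1994
  Summit.BirchSwinnertonDyer.BirchSwinnertonDyer.Theorems.BiquadraticEisensteinDescentHeegnerTwistCouplingInSupplyThreeSquaresPin
  Summit.BirchSwinnertonDyer.BirchSwinnertonDyer.Theorems.BiquadraticEisensteinDescentHeegnerTwistCouplingInSupplyThreeSquaresPinDual
  Summit.BirchSwinnertonDyer.BirchSwinnertonDyer.Theorems.BiquadraticEisensteinDescentHeegnerTwistCouplingInSupplyMonskyCells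

/-! ## §1 The partner primes `3` and `5` -/

/-- `(3/p) = +1` for `p ≡ 11 (mod 12)`: `(3/p) = −(p/3) = −(2/3) = +1`. [folklore] -/
theorem jacobiSym_three_eq_one {p : ℕ} (hp12 : p % 12 = 11) : jacobiSym 3 p = 1 := by
  have hrec := jacobiSym.quadratic_reciprocity_three_mod_four (a := 3) (b := p) (by norm_num) (by omega)
  have hp3 : jacobiSym (p : ℤ) 3 = -1 := by
    rw [jacobiSym.mod_left (p : ℤ) 3]
    have h23 : (p : ℤ) % ((3 : ℕ) : ℤ) = 2 := by
      push_cast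
      omega
    rw [h23, jacobiSym.at_two (by decide : Odd 3), ZMod.χ₈_nat_eq_if_mod_eight]
    decide
  have h3 : ((3 : ℕ) : ℤ) = 3 := by norm_num
  rw [h3] at hrec
  rw [hrec, hp3, neg_neg]

/-- `(5/p) = +1` for odd `p ≡ ±1 (mod 5)`: `(5/p) = (p/5) ∈ {(1/5), (4/5)} = {+1}`. [folklore] -/
theorem jacobiSym_five_eq_one {p : ℕ} (hp2 : p % 2 = 1) (hp5 : p % 5 = 1 ∨ p % 5 = 4) : jacobiSym 5 p = 1 := by
  have hpodd : Odd p := Nat.odd_iff.mpr hp2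
  have hrec := jacobiSym.quadratic_reciprocity_one_mod_four (a := 5) (b := p) (by norm_num) hpodd
  have hcast : ((5 : ℕ) : ℤ) = 5 := by norm_num
  rw [hcast] at hrec
  rw [hrec, jacobiSym.mod_left (p : ℤ) 5]
  rcases hp5 with h | h
  · have h15 : (p : ℤ) % ((5 : ℕ) : ℤ) = 1 := by
      push_cast
      omega
    rw [h15]
    exact jacobiSym.one_left 5
  · have h45 : (p : ℤ) % ((5 : ℕ) : ℤ) = 2 ^ 2 := by
      push_cast
      omega
    rw [h45]
    exact jacobiSym.sq_one' (by decide)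

/-! ## §2 Three-term vectors -/

/-- A three-term vector with pairwise distinct entries is injective. [folklore] -/
theorem vecTriple_injective {a b c : ℕ} (hab : a ≠ b) (hac : a ≠ c) (hbc : b ≠ c) :
    Function.Injective (![a, b, c] : Fin 3 → ℕ) := by
  intro i j h
  fin_cases i <;> fin_cases j <;> simp_all [hab.symm, hac.symm, hbc.symm]

/-- `2 · ∏ ![a, b, c] = 2a(bc)`. [folklore] -/
theorem two_mul_prod_vecTriple (a b c : ℕ) : 2 * ∏ i, (![a, b, c] : Fin 3 → ℕ) i = 2 * a * (b * c) := by
  simp [Fin.prod_univ_three]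
  ring

/-- `∏ ![a, b, c] = a(bc)`. [folklore] -/
theorem prod_vecTriple (a b c : ℕ) : ∏ i, (![a, b, c] : Fin 3 → ℕ) i = a * (b * c) := by
  simp [Fin.prod_univ_three]
  ring

/-! ## §3 The cells at the partner primes -/

/-- Cell A at the partner `q = 3` (corner `E_{2p}`, `p ≡ 11 (mod 12)`): `det M_even(p, 3, ℓ) = 1` for the pinned `ℓ`.
[cite: HeathBrown1994SelmerCongruentII, Appendix (Monsky), typescript p. 41 L20–L36 (the matrix; evaluation ours)] -/
theorem det_monskyMatrixEven_three_pin {p l : ℕ} (hp12 : p % 12 = 11) (hl : l.Prime) (hl8 : l % 8 = 5)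
    (hlp : jacobiSym (l : ℤ) p = -1) : (monskyMatrixEven ![p, 3, l]).det = 1 :=
  det_monskyMatrixEven_cellA Nat.prime_three hl (by omega) (by norm_num) hl8
    (by exact_mod_cast jacobiSym_three_eq_one hp12) hlp

/-- Row-1 cell at the partner `q = 3` (corner `E_p`, `p ≡ 23 (mod 24)`): `det M_odd(p, 3, ℓ) = 1` for the pinned `ℓ`.
[cite: HeathBrown1994SelmerCongruentII, Appendix (Monsky), typescript p. 39 L27–L33 (the matrix; evaluation ours)] -/
theorem det_monskyMatrixOdd_three_pin {p l : ℕ} (hp : p.Prime) (hp24 : p % 24 = 23) (hl : l.Prime) (hl8 : l % 8 = 5)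
    (hlp : jacobiSym (l : ℤ) p = -1) : (monskyMatrixOdd ![p, 3, l]).det = 1 :=
  det_monskyMatrixOdd_cell_seven_mod_eight hp Nat.prime_three hl (by omega) (by norm_num) hl8 hlp

/-- Cell B at the partner `5` (corner `E_{2p}`, `p ≡ ±1 (mod 5)`): `det M_even(p, ℓ′, 5) = 1` for the dual pin `ℓ′`.
[cite: HeathBrown1994SelmerCongruentII, Appendix (Monsky), typescript p. 41 L20–L36 (the matrix; evaluation ours)] -/
theorem det_monskyMatrixEven_dualPin_five {p q : ℕ} (hp4 : p % 4 = 3) (hp5 : p % 5 = 1 ∨ p % 5 = 4) (hq : q.Prime)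
    (hq8 : q % 8 = 3) (hqp : jacobiSym (q : ℤ) p = -1) : (monskyMatrixEven ![p, q, 5]).det = 1 :=
  det_monskyMatrixEven_cellB hq Nat.prime_five hp4 hq8 (by norm_num) hqp
    (by exact_mod_cast jacobiSym_five_eq_one (by omega) hp5)

/-! ## §4 Analytic rank zero of the Heegner twist, modulo the four named facts -/

/-- The journal door for a three-term vector, restated on the literal product `2a(bc)`: Monsky (even) + `det M = 1` +
Burungale–Tian + Deuring–Hecke + Burungale–Flach ⟹ `E_{2a(bc)}` is square-free-indexed, has the BSD triple, analytic rank
`0` and `L(E_{2a(bc)}, 1) ≠ 0`. [cite: HeathBrown1994SelmerCongruentII, Appendix (Monsky), typescript p. 41 L20–L36]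
[cite: BurungaleTian2026, Thm. 1.1] [cite: BurungaleFlach2024, Thm. 1.1 and Cor. 2] -/
theorem analyticRank_eq_zero_of_det_even {a b c : ℕ} (hM : monsky_card_selmerGroup_two_even)
    (hBT : burungaleTian_analyticRank_eq_zero_of_selmerCorank_eq_zero_of_hasCM)
    (hH : hasEntireLFunction_of_j_mem_maximalCMJInvariants) (hBF : bsdTriple_of_hasCM_of_L_one_ne_zero)
    (ha : a.Prime) (hb : b.Prime) (hc : c.Prime) (ha2 : a % 2 = 1) (hb2 : b % 2 = 1) (hc2 : c % 2 = 1)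
    (hab : a ≠ b) (hac : a ≠ c) (hbc : b ≠ c) (hdet : (monskyMatrixEven ![a, b, c]).det = 1) :
    Squarefree (2 * a * (b * c)) ∧ (congruentNumberCurve (2 * a * (b * c))).BSDTriple ∧
      (congruentNumberCurve (2 * a * (b * c))).analyticRank = 0 ∧
      (congruentNumberCurve (2 * a * (b * c))).entireLFunction 1 ≠ 0 := by
  have hprime : ∀ i, ((![a, b, c] : Fin 3 → ℕ) i).Prime := by
    intro i
    fin_cases i <;> assumption
  have hodd : ∀ i, Odd ((![a, b, c] : Fin 3 → ℕ) i) := by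
    intro i
    fin_cases i
    · exact Nat.odd_iff.mpr ha2
    · exact Nat.odd_iff.mpr hb2
    · exact Nat.odd_iff.mpr hc2
  have hinj := vecTriple_injective hab hac hbc
  have h := bsdTriple_of_monsky_of_BT_BF_even (![a, b, c] : Fin 3 → ℕ) hM hBT hH hBF hprime hodd hinj hdet
  have hsq0 := squarefree_two_mul_prod_of_injective (![a, b, c] : Fin 3 → ℕ) hprime hodd hinj
  have hprod := two_mul_prod_vecTriple a b c
  rw [hprod] at hsq0
  simp only [hprod] at h
  obtain ⟨⟨hB, -, hA⟩, -⟩ := h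
  haveI := isElliptic_congruentNumberCurve (Squarefree.ne_zero hsq0)
  have hE : (congruentNumberCurve (2 * a * (b * c))).HasEntireLFunction :=
    hH _ (congruentNumberCurve_j_mem_maximalCMJInvariants _)
  exact ⟨hsq0, hB, hA, ((congruentNumberCurve (2 * a * (b * c))).analyticRank_eq_zero_iff_holds hE).mp hA⟩

/-- The journal door for a three-term vector, odd product `a(bc)`. [cite: HeathBrown1994SelmerCongruentII, Appendix (Monsky), typescript p. 39 L27–L33]
[cite: BurungaleTian2026, Thm. 1.1] [cite: BurungaleFlach2024, Thm. 1.1 and Cor. 2] -/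
theorem analyticRank_eq_zero_of_det_odd {a b c : ℕ} (hM : monsky_card_selmerGroup_two_odd)
    (hBT : burungaleTian_analyticRank_eq_zero_of_selmerCorank_eq_zero_of_hasCM)
    (hH : hasEntireLFunction_of_j_mem_maximalCMJInvariants) (hBF : bsdTriple_of_hasCM_of_L_one_ne_zero)
    (ha : a.Prime) (hb : b.Prime) (hc : c.Prime) (ha2 : a % 2 = 1) (hb2 : b % 2 = 1) (hc2 : c % 2 = 1)
    (hab : a ≠ b) (hac : a ≠ c) (hbc : b ≠ c) (hdet : (monskyMatrixOdd ![a, b, c]).det = 1) :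
    Squarefree (a * (b * c)) ∧ (congruentNumberCurve (a * (b * c))).BSDTriple ∧
      (congruentNumberCurve (a * (b * c))).analyticRank = 0 ∧
      (congruentNumberCurve (a * (b * c))).entireLFunction 1 ≠ 0 := by
  have hprime : ∀ i, ((![a, b, c] : Fin 3 → ℕ) i).Prime := by
    intro i
    fin_cases i <;> assumption
  have hodd : ∀ i, Odd ((![a, b, c] : Fin 3 → ℕ) i) := by
    intro i
    fin_cases i
    · exact Nat.odd_iff.mpr ha2
    · exact Nat.odd_iff.mpr hb2
    · exact Nat.odd_iff.mpr hc2
  have hinj := vecTriple_injective hab hac hbc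
  have h := bsdTriple_of_monsky_of_BT_BF_odd (![a, b, c] : Fin 3 → ℕ) hM hBT hH hBF hprime hodd hinj hdet
  have hsq0 := squarefree_prod_of_injective (![a, b, c] : Fin 3 → ℕ) hprime hinj
  have hprod := prod_vecTriple a b c
  rw [hprod] at hsq0
  simp only [hprod] at h
  obtain ⟨⟨hB, -, hA⟩, -⟩ := h
  haveI := isElliptic_congruentNumberCurve (Squarefree.ne_zero hsq0)
  have hE : (congruentNumberCurve (a * (b * c))).HasEntireLFunction :=
    hH _ (congruentNumberCurve_j_mem_maximalCMJInvariants _)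
  exact ⟨hsq0, hB, hA, ((congruentNumberCurve (a * (b * c))).analyticRank_eq_zero_iff_holds hE).mp hA⟩

/-- **Corner `W = E_{2p}`, `p ≡ 11 (mod 12)` — the `L`-half of the card's `CruxOnE2pCornerMod12`, modulo the four named
facts.** For every prime `p ≡ 11 (mod 12)` there is a prime `ℓ < 2p`, `ℓ ≡ 5 (mod 8)`, `(ℓ/p) = −1` (the three-squares
pin), with `d = −3ℓ ≡ 1 (mod 8)`, `(d/p) = +1` (so `2` and `p`, the primes of `N(E_{2p})`, split in `ℚ(√d)`), `|d| = 3ℓ < 6p`,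
such that the Heegner twist `E_{2p}^{(d)} = E_{2p·3ℓ}` has analytic rank `0`, `L(E_{2p·3ℓ}, 1) ≠ 0` and the BSD triple.
[cite: HeathBrown1994SelmerCongruentII, Appendix (Monsky), typescript p. 41 L20–L36] [cite: BurungaleTian2026, Thm. 1.1]
[cite: BurungaleFlach2024, Thm. 1.1 and Cor. 2] -/
theorem exists_pin_analyticRank_eq_zero_two_p (hM : monsky_card_selmerGroup_two_even)
    (hBT : burungaleTian_analyticRank_eq_zero_of_selmerCorank_eq_zero_of_hasCM)
    (hH : hasEntireLFunction_of_j_mem_maximalCMJInvariants) (hBF : bsdTriple_of_hasCM_of_L_one_ne_zero)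
    {p : ℕ} (hp : p.Prime) (hp12 : p % 12 = 11) :
    ∃ ℓ : ℕ, ℓ.Prime ∧ ℓ < 2 * p ∧ ℓ % 8 = 5 ∧ jacobiSym (ℓ : ℤ) p = -1 ∧
      (-(3 * (ℓ : ℤ))) % 8 = 1 ∧ jacobiSym (-(3 * (ℓ : ℤ))) p = 1 ∧ 3 * ℓ < 6 * p ∧
      Squarefree (2 * p * (3 * ℓ)) ∧ (congruentNumberCurve (2 * p * (3 * ℓ))).BSDTriple ∧
      (congruentNumberCurve (2 * p * (3 * ℓ))).analyticRank = 0 ∧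
      (congruentNumberCurve (2 * p * (3 * ℓ))).entireLFunction 1 ≠ 0 := by
  obtain ⟨ℓ, hℓ, hlt, hℓ8, hJ, h8, hJ3, hsz⟩ := exists_pin_heegnerData hp hp12
  have hdet := det_monskyMatrixEven_three_pin hp12 hℓ hℓ8 hJ
  obtain ⟨hsq, hB, hA, hL⟩ := analyticRank_eq_zero_of_det_even hM hBT hH hBF hp Nat.prime_three hℓ (by omega)
    (by norm_num) (by omega) (by omega) (by omega) (by omega) hdet
  exact ⟨ℓ, hℓ, hlt, hℓ8, hJ, h8, hJ3, hsz, hsq, hB, hA, hL⟩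

/-- **Corner `W = E_p`, `p ≡ 23 (mod 24)` — the `L`-half of the card's `CruxOnEpCornerMod24`, modulo the four named
facts** (odd case of Monsky's theorem): a pinned prime `ℓ` as above with the Heegner twist `E_p^{(−3ℓ)} = E_{p·3ℓ}` of
analytic rank `0`. [cite: HeathBrown1994SelmerCongruentII, Appendix (Monsky), typescript p. 39 L27–L33]
[cite: BurungaleTian2026, Thm. 1.1] [cite: BurungaleFlach2024, Thm. 1.1 and Cor. 2] -/
theorem exists_pin_analyticRank_eq_zero_p (hM : monsky_card_selmerGroup_two_odd)
    (hBT : burungaleTian_analyticRank_eq_zero_of_selmerCorank_eq_zero_of_hasCM)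
    (hH : hasEntireLFunction_of_j_mem_maximalCMJInvariants) (hBF : bsdTriple_of_hasCM_of_L_one_ne_zero)
    {p : ℕ} (hp : p.Prime) (hp24 : p % 24 = 23) :
    ∃ ℓ : ℕ, ℓ.Prime ∧ ℓ < 2 * p ∧ ℓ % 8 = 5 ∧ jacobiSym (ℓ : ℤ) p = -1 ∧
      (-(3 * (ℓ : ℤ))) % 8 = 1 ∧ jacobiSym (-(3 * (ℓ : ℤ))) p = 1 ∧ 3 * ℓ < 6 * p ∧
      Squarefree (p * (3 * ℓ)) ∧ (congruentNumberCurve (p * (3 * ℓ))).BSDTriple ∧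
      (congruentNumberCurve (p * (3 * ℓ))).analyticRank = 0 ∧
      (congruentNumberCurve (p * (3 * ℓ))).entireLFunction 1 ≠ 0 := by
  obtain ⟨ℓ, hℓ, hlt, hℓ8, hJ, h8, hJ3, hsz⟩ := exists_pin_heegnerData hp (by omega)
  have hdet := det_monskyMatrixOdd_three_pin hp hp24 hℓ hℓ8 hJ
  obtain ⟨hsq, hB, hA, hL⟩ := analyticRank_eq_zero_of_det_odd hM hBT hH hBF hp Nat.prime_three hℓ (by omega)
    (by norm_num) (by omega) (by omega) (by omega) (by omega) hdet
  exact ⟨ℓ, hℓ, hlt, hℓ8, hJ, h8, hJ3, hsz, hsq, hB, hA, hL⟩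

/-- **Corner `W = E_{2p}`, `p ≡ 7 (mod 8)`, `p ≡ ±1 (mod 5)` — the `L`-half of the card's `CruxOnE2pCornerMod5` on the
`p ≡ 7 (mod 8)` half, modulo the four named facts**: a dual-pinned prime `ℓ′ < p`, `ℓ′ ≡ 3 (mod 8)`, `(ℓ′/p) = −1`, with
`d = −5ℓ′ ≡ 1 (mod 8)`, `(d/p) = +1`, `5ℓ′ < 5p`, such that `E_{2p}^{(d)} = E_{2p·5ℓ′}` has analytic rank `0`.
[cite: HeathBrown1994SelmerCongruentII, Appendix (Monsky), typescript p. 41 L20–L36] [cite: BurungaleTian2026, Thm. 1.1]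
[cite: BurungaleFlach2024, Thm. 1.1 and Cor. 2] -/
theorem exists_dualPin_analyticRank_eq_zero_two_p (hM : monsky_card_selmerGroup_two_even)
    (hBT : burungaleTian_analyticRank_eq_zero_of_selmerCorank_eq_zero_of_hasCM)
    (hH : hasEntireLFunction_of_j_mem_maximalCMJInvariants) (hBF : bsdTriple_of_hasCM_of_L_one_ne_zero)
    {p : ℕ} (hp : p.Prime) (hp8 : p % 8 = 7) (hp5 : p % 5 = 1 ∨ p % 5 = 4) :
    ∃ ℓ : ℕ, ℓ.Prime ∧ ℓ < p ∧ ℓ % 8 = 3 ∧ jacobiSym (ℓ : ℤ) p = -1 ∧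
      (-(5 * (ℓ : ℤ))) % 8 = 1 ∧ jacobiSym (-(5 * (ℓ : ℤ))) p = 1 ∧ 5 * ℓ < 5 * p ∧
      Squarefree (2 * p * (ℓ * 5)) ∧ (congruentNumberCurve (2 * p * (ℓ * 5))).BSDTriple ∧
      (congruentNumberCurve (2 * p * (ℓ * 5))).analyticRank = 0 ∧
      (congruentNumberCurve (2 * p * (ℓ * 5))).entireLFunction 1 ≠ 0 := by
  obtain ⟨ℓ, hℓ, hlt, hℓ8, hJ, h8, hJ5, hsz⟩ := exists_dualPin_heegnerData hp hp8 hp5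
  have hdet := det_monskyMatrixEven_dualPin_five (by omega) hp5 hℓ hℓ8 hJ
  have hp5' : p ≠ 5 := by
    rintro rfl
    omega
  have hℓ5 : ℓ ≠ 5 := by
    rintro rfl
    omega
  obtain ⟨hsq, hB, hA, hL⟩ := analyticRank_eq_zero_of_det_even hM hBT hH hBF hp hℓ Nat.prime_five (by omega)
    (by omega) (by norm_num) (by omega) hp5' hℓ5 hdet
  exact ⟨ℓ, hℓ, hlt, hℓ8, hJ, h8, hJ5, hsz, hsq, hB, hA, hL⟩

end Summit.BirchSwinnertonDyer.BirchSwinnertonDyer.Theorems.BiquadraticEisensteinDescentHeegnerTwistCouplingInSupplyThreeSquaresPinRankZero
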